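import Summits.KontsevichZagierPeriods.KontsevichZagierPeriods.Theorems.SoloBlindZetaTwoSquare
import Summits.KontsevichZagierPeriods.KontsevichZagierPeriods.Theorems.SoloBlindZetaBox
import Summits.KontsevichZagierPeriods.KontsevichZagierPeriods.Theorems.SoloBlindSerretReps
import Literature.NumberTheory.Transcendental.AperyIrrationality
import HarnessLib

/-!
# Twisted sectors: the Kontsevich–Zagier conjecture on `[s]·M` for ANY representation `s`

Solo programme `solo-KontsevichZagierPeriods-blind`, session 5.

## The mechanism

Call a `K₀`-submodule `M ⊆ Q` (`K₀ = ℚ̄ ∩ ℝ`, `Q = FormalRep ⧸ relations` the ring of classes of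
integral representations, `SoloBlindBoxRing`) **eval-injective** when the period map `evalQ` is
injective on it.  The decided sectors of this programme are all of this form: the cell span `V`
(values `β + Σ γᵢ log αᵢ + δπ`; Baker), the `π`-sector `K₀[x_π]` (Lindemann), the homogeneous
sectors `H_k(μ)` (Gelfond–Schneider), the `ζ(3)`-line (Apéry) …

**Twist.**  If `M` is eval-injective and `b ∈ Q` is ANY class with non-zero period, then the
twisted module `b·M` is eval-injective again: `evalQ (b y) = evalQ b · evalQ y = 0` forces
`evalQ y = 0`, hence `y = 0`.  Consequently the Kontsevich–Zagier conjecture holds for every pair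
of integral representations whose classes lie in `b·M` (`kz_twistSector`).

The point is that **no arithmetic information whatsoever about the period of `b` is used** — only
that it is non-zero.  With `b = [B₃]` (Kontsevich's box for `ζ(3)`, period `ζ(3) > 0`) and
`M = V` we decide, inside the KZ rules, all pairs of four-dimensional representations
`B₃ × c`, `B₃ × c'` (`c, c'` rational cells of dimension `≤ 1`) with equal periods — e.g.

* `B₃ × L(1;4) ∼ B₃ × L(2;2)`          (`ζ(3) log 4 = 2 ζ(3) log 2`, `kz_zetaThree_log_four`);
* `B₃ × A(1;1) ∼ B₃ × A(1;½) + B₃ × A(1;⅓)`  (Euler's Machin formula times `ζ(3)`,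
  `zetaThree_machin_mem_relations`),

although nothing is known about the arithmetic nature of `ζ(3) log 2` or `ζ(3) π`.  The same holds
with `b` the class of any representation with non-zero period (Beukers' integrals, `B₅`, the
dilogarithm box …) and with `M` any decided sector (`evalInjective_adjoin_xPi` records the
`π`-sector in this language).

Honest scope: `[s]·M` for ONE class `[s]`; a sum `[s]·M + [s']·M` would need the independence
of the two periods over `evalQ M`, which is exactly the kind of input the conjecture hides.
-/

noncomputable section

namespace Summit.KontsevichZagierPeriods.KontsevichZagierPeriods.Theorems.SoloBlind

open Set MeasureTheory
open Literature.NumberTheory.Transcendental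
open Literature.NumberTheory.Transcendental.KZ

/-! ## Eval-injective submodules -/

/-- A `K₀`-submodule of `Q` is *eval-injective* if the period map is injective on it. -/
def EvalInjective (M : Submodule K₀ Q) : Prop := ∀ ⦃y : Q⦄, y ∈ M → evalQ y = 0 → y = 0

/-- The cell span `V` (classes of rational representations of dimension `≤ 1`) is
eval-injective (`SoloBlindBoxRankOne`: Baker + Lindemann). -/
theorem evalInjective_cellSpan : EvalInjective cellSpan := fun _ hy h0 =>
  eq_zero_of_mem_cellSpan hy h0

/-- The `π`-sector `K₀[x_π]` is eval-injective (`SoloBlindZetaTwoSquare`: transcendence of `π`). -/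
theorem evalInjective_adjoin_xPi :
    EvalInjective (Subalgebra.toSubmodule (Algebra.adjoin K₀ {xPi})) := by
  intro y hy h0
  obtain ⟨z, rfl⟩ := mkQ_surjective y
  exact mkQ_eq_zero_iff.mpr (piSector_kernel (mem_piSector.mpr hy) h0)

/-- KZ on an eval-injective submodule, kernel form. -/
theorem evalInjective_kernel {M : Submodule K₀ Q} (hM : EvalInjective M) {z : FormalRep}
    (hz : mkQ z ∈ M) (h0 : eval z = 0) : z ∈ relations :=
  mkQ_eq_zero_iff.mp (hM hz h0)

/-! ## Twisted sectors `b·M` -/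

/-- The twisted sector `{z | [z] ∈ b·M}` of a class `b ∈ Q` and a submodule `M ⊆ Q`. -/
def twistSector (b : Q) (M : Submodule K₀ Q) : AddSubgroup FormalRep where
  carrier := {z | ∃ y ∈ M, mkQ z = b * y}
  zero_mem' := ⟨0, zero_mem _, by rw [map_zero, mul_zero]⟩
  add_mem' := by
    rintro z w ⟨y, hy, hz⟩ ⟨y', hy', hw⟩
    exact ⟨y + y', add_mem hy hy', by rw [map_add, hz, hw, mul_add]⟩
  neg_mem' := by
    rintro z ⟨y, hy, hz⟩
    exact ⟨-y, neg_mem hy, by rw [map_neg, hz, mul_neg]⟩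

/-- Membership in the twisted sector. -/
theorem mem_twistSector {b : Q} {M : Submodule K₀ Q} {z : FormalRep} :
    z ∈ twistSector b M ↔ ∃ y ∈ M, mkQ z = b * y := Iff.rfl

/-- Every relation lies in every twisted sector. -/
theorem relations_le_twistSector {b : Q} {M : Submodule K₀ Q} {z : FormalRep}
    (hz : z ∈ relations) : z ∈ twistSector b M :=
  ⟨0, zero_mem _, by rw [mkQ_eq_zero_iff.mpr hz, mul_zero]⟩

/-- Twisted sectors are closed under the `K₀`-action on classes. -/
theorem mem_twistSector_of_mkQ_eq_smul {b : Q} {M : Submodule K₀ Q} {z w : FormalRep} (β : K₀)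
    (hw : w ∈ twistSector b M) (h : mkQ z = β • mkQ w) : z ∈ twistSector b M := by
  obtain ⟨y, hy, hwy⟩ := hw
  exact ⟨β • y, M.smul_mem β hy, by rw [h, hwy, mul_smul_comm]⟩

/-- A representation equivalent to a member of a twisted sector is a member. -/
theorem mem_twistSector_of_equivalent {b : Q} {M : Submodule K₀ Q} {n m : ℕ} {r : IntegralRep n}
    {r' : IntegralRep m} (h : Equivalent r r') (hr' : of r' ∈ twistSector b M) :
    of r ∈ twistSector b M := by
  have e : of r = (of r - of r') + of r' := by abel
  rw [e]
  exact add_mem (relations_le_twistSector h) hr'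

/-- **Kernel form: KZ holds on `b·M`** whenever `M` is eval-injective and `evalQ b ≠ 0`. -/
theorem twistSector_kernel {b : Q} {M : Submodule K₀ Q} (hM : EvalInjective M)
    (hb : evalQ b ≠ 0) {z : FormalRep} (hz : z ∈ twistSector b M) (h0 : eval z = 0) :
    z ∈ relations := by
  obtain ⟨y, hy, hzy⟩ := hz
  have h : evalQ b * evalQ y = 0 := by rw [← map_mul, ← hzy, evalQ_mkQ, h0]
  have hy0 : y = 0 := hM hy ((mul_eq_zero.mp h).resolve_left hb)
  exact mkQ_eq_zero_iff.mp (by rw [hzy, hy0, mul_zero])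

/-- **The Kontsevich–Zagier conjecture on a twisted sector.**  Two integral representations with
classes in `b·M` (`M` eval-injective, `evalQ b ≠ 0`) and equal periods are KZ-equivalent. -/
theorem kz_twistSector {b : Q} {M : Submodule K₀ Q} (hM : EvalInjective M) (hb : evalQ b ≠ 0)
    {n m : ℕ} (r : IntegralRep n) (r' : IntegralRep m) (hr : of r ∈ twistSector b M)
    (hr' : of r' ∈ twistSector b M) (hv : r.value = r'.value) : Equivalent r r' :=
  twistSector_kernel hM hb (sub_mem hr hr') (by rw [map_sub, eval_of, eval_of, hv, sub_self])

/-! ## Products with a fixed representation -/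

/-- `s × c ∈ [s]·M` whenever `[c] ∈ M`. -/
theorem of_prod_mem_twistSector {n m : ℕ} (s : IntegralRep n) {c : IntegralRep m}
    {M : Submodule K₀ Q} (hc : mkQ (of c) ∈ M) :
    of (s.prod c) ∈ twistSector (mkQ (of s)) M :=
  ⟨mkQ (of c), hc, by rw [← of_mul_of, mkQ_mul]⟩

/-- `c × s ∈ [s]·M` whenever `[c] ∈ M` (`Q` is commutative). -/
theorem of_prod_mem_twistSector' {n m : ℕ} (s : IntegralRep n) {c : IntegralRep m}
    {M : Submodule K₀ Q} (hc : mkQ (of c) ∈ M) :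
    of (c.prod s) ∈ twistSector (mkQ (of s)) M :=
  ⟨mkQ (of c), hc, by rw [← of_mul_of, mkQ_mul, mul_comm]⟩

/-- `s × c ∈ [s]·V` for every rational cell `c` of dimension `≤ 1`. -/
theorem of_prod_cell_mem_twistSector {n m : ℕ} (s : IntegralRep n) (c : IntegralRep m)
    (hm : m ≤ 1) (hc : c.IsRational) : of (s.prod c) ∈ twistSector (mkQ (of s)) cellSpan :=
  of_prod_mem_twistSector s (mkQ_of_mem_cellSpan c hm hc)

/-- **KZ for `s × (cells)`.**  For ANY integral representation `s` with non-zero period, two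
members of `[s]·V` with equal periods are KZ-equivalent. -/
theorem kz_twist_cellSpan {n k l : ℕ} {s : IntegralRep n} (hs : s.value ≠ 0) (r : IntegralRep k)
    (r' : IntegralRep l) (hr : of r ∈ twistSector (mkQ (of s)) cellSpan)
    (hr' : of r' ∈ twistSector (mkQ (of s)) cellSpan) (hv : r.value = r'.value) :
    Equivalent r r' :=
  kz_twistSector evalInjective_cellSpan (by rwa [evalQ_mkQ, eval_of]) r r' hr hr' hv

/-- **KZ for the products `s × c`, `s × c'`** (`s` any representation with non-zero period,
`c, c'` rational of dimension `≤ 1`): equal periods imply KZ-equivalence. -/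
theorem kz_prod_cells {n m m' : ℕ} {s : IntegralRep n} (hs : s.value ≠ 0) {c : IntegralRep m}
    {c' : IntegralRep m'} (hm : m ≤ 1) (hm' : m' ≤ 1) (hc : c.IsRational) (hc' : c'.IsRational)
    (hv : (s.prod c).value = (s.prod c').value) : Equivalent (s.prod c) (s.prod c') :=
  kz_twist_cellSpan hs _ _ (of_prod_cell_mem_twistSector s c hm hc)
    (of_prod_cell_mem_twistSector s c' hm' hc') hv

/-! ## Instances with `b = [B₃]`: periods `ζ(3)·log μ`, `ζ(3)·π` of unknown nature -/

/-- Kontsevich's box `B₃ = [(0,1)³, 1/(1 - xyz)]`, period `ζ(3)`. -/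
abbrev zetaThreeBox : IntegralRep 3 := boxZetaRep 3 (by norm_num)

/-- `value B₃ = ζ(3) ≠ 0`. -/
theorem zetaThreeBox_value_ne_zero : zetaThreeBox.value ≠ 0 := by
  rw [boxZetaRep_value]
  exact Apery.zeta_three_pos.ne'

/-- `4` is real algebraic. -/
theorem isAlgebraic_four_real : IsAlgebraic ℚ (4 : ℝ) := by
  simpa using isAlgebraic_nat (R := ℚ) (A := ℝ) 4

/-- `L(1;4) = [[1,4], dx/x]`, the rational cell of `log 4`. -/
def logFourCell : IntegralRep 1 := logCell ((1:ℚ):ℝ) 4 (isAlgebraic_rat ℚ 1) isAlgebraic_four_real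

/-- `L(2;2) = [[1,2], 2dx/x]`, the rational cell of `2 log 2`. -/
def twoLogTwoCell : IntegralRep 1 :=
  logCell ((2:ℚ):ℝ) 2 (isAlgebraic_rat ℚ 2) (by simpa using isAlgebraic_nat (R := ℚ) (A := ℝ) 2)

/-- `value L(1;4) = 2 log 2`. -/
theorem logFourCell_value : logFourCell.value = 2 * Real.log 2 := by
  rw [logFourCell, value_logCell (by norm_num : (1:ℝ) ≤ 4), Rat.cast_one, one_mul,
    show (4:ℝ) = 2 ^ 2 by norm_num, Real.log_pow]
  norm_num

/-- `value L(2;2) = 2 log 2`. -/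
theorem twoLogTwoCell_value : twoLogTwoCell.value = 2 * Real.log 2 := by
  rw [twoLogTwoCell, value_logCell (by norm_num : (1:ℝ) ≤ 2), Rat.cast_ofNat]

/-- **`B₃ × L(1;4) ∼ B₃ × L(2;2)`**: two four-dimensional representations of `ζ(3) log 4` are
KZ-equivalent — with no input on the arithmetic of `ζ(3) log 2`. -/
theorem kz_zetaThree_log_four :
    Equivalent (zetaThreeBox.prod logFourCell) (zetaThreeBox.prod twoLogTwoCell) :=
  kz_prod_cells zetaThreeBox_value_ne_zero le_rfl le_rfl (isRational_logCell 1 _)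
    (isRational_logCell 2 _)
    (by rw [IntegralRep.value_prod, IntegralRep.value_prod, logFourCell_value,
      twoLogTwoCell_value])

/-- `A(1;q) = [[0,q], dx/(1+x²)]` for `q ∈ ℚ`, the rational cell of `arctan q`. -/
def atanRatCell (q : ℚ) : IntegralRep 1 :=
  atanCell ((1:ℚ):ℝ) (q:ℝ) (isAlgebraic_rat ℚ 1) (isAlgebraic_rat ℚ q)

/-- `value A(1;q) = arctan q` for `0 ≤ q`. -/
theorem atanRatCell_value {q : ℚ} (hq : 0 ≤ q) : (atanRatCell q).value = Real.arctan q := by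
  rw [atanRatCell, value_atanCell (Rat.cast_nonneg.mpr hq), Rat.cast_one, one_mul]

/-- `A(1;q)` is rational. -/
theorem isRational_atanRatCell (q : ℚ) : (atanRatCell q).IsRational :=
  isRational_atanCell 1 (isAlgebraic_rat ℚ q)

/-- Euler's Machin formula `arctan 1 = arctan ½ + arctan ⅓`. -/
theorem arctan_one_eq_arctan_half_add_arctan_third :
    Real.arctan 1 = Real.arctan ((1/2 : ℚ) : ℝ) + Real.arctan ((1/3 : ℚ) : ℝ) := by
  rw [Real.arctan_add (by push_cast; norm_num)]
  congr 1
  push_cast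
  norm_num

/-- **Euler's Machin formula times `ζ(3)`, inside the KZ rules**:
`[B₃ × A(1;1)] = [B₃ × A(1;½)] + [B₃ × A(1;⅓)]` — three four-dimensional representations with
periods `ζ(3)π/4`, `ζ(3) arctan ½`, `ζ(3) arctan ⅓`. -/
theorem zetaThree_machin_mem_relations :
    of (zetaThreeBox.prod (atanRatCell 1)) - of (zetaThreeBox.prod (atanRatCell (1/2)))
      - of (zetaThreeBox.prod (atanRatCell (1/3))) ∈ relations := by
  refine twistSector_kernel evalInjective_cellSpan (b := mkQ (of zetaThreeBox))
    (by rw [evalQ_mkQ, eval_of]; exact zetaThreeBox_value_ne_zero)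
    (sub_mem (sub_mem ?_ ?_) ?_) ?_
  · exact of_prod_cell_mem_twistSector _ _ le_rfl (isRational_atanRatCell 1)
  · exact of_prod_cell_mem_twistSector _ _ le_rfl (isRational_atanRatCell _)
  · exact of_prod_cell_mem_twistSector _ _ le_rfl (isRational_atanRatCell _)
  · rw [map_sub, map_sub, eval_of, eval_of, eval_of, IntegralRep.value_prod,
      IntegralRep.value_prod, IntegralRep.value_prod, atanRatCell_value zero_le_one,
      atanRatCell_value (by norm_num), atanRatCell_value (by norm_num), Rat.cast_one,
      arctan_one_eq_arctan_half_add_arctan_third]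
    ring

/-- **KZ for `B₃ × c` against any member of `[B₃]·V`**, e.g. `B₃ × A(1;1)` against sums of
`B₃ × (cells)` with period `ζ(3)π/4`. -/
theorem kz_zetaThreeBox_prod {m l : ℕ} (c : IntegralRep m) (hm : m ≤ 1) (hc : c.IsRational)
    (r' : IntegralRep l) (hr' : of r' ∈ twistSector (mkQ (of zetaThreeBox)) cellSpan)
    (hv : (zetaThreeBox.prod c).value = r'.value) : Equivalent (zetaThreeBox.prod c) r' :=
  kz_twist_cellSpan zetaThreeBox_value_ne_zero _ _
    (of_prod_cell_mem_twistSector _ c hm hc) hr' hv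

/-! ## The `π`-sector twisted: `[s]·K₀[x_π]` -/

/-- `s × p ∈ [s]·K₀[x_π]` for every `p` in the `π`-sector (products of `Z`, `S`, arctangent
cells, …). -/
theorem of_prod_mem_twistSector_pi {n m : ℕ} (s : IntegralRep n) {p : IntegralRep m}
    (hp : of p ∈ piSector) :
    of (s.prod p) ∈ twistSector (mkQ (of s)) (Subalgebra.toSubmodule (Algebra.adjoin K₀ {xPi})) :=
  of_prod_mem_twistSector s (mem_piSector.mp hp)

/-- **KZ on `[s]·K₀[x_π]`** for any `s` with non-zero period: e.g. `B₃ × S ∼ B₃ × Z`,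
`B₃ × S × S` against `B₃ × (36/256-rescaled (2A)⁴)`-type representations of `ζ(3)π⁴/36`. -/
theorem kz_twist_piSector {n k l : ℕ} {s : IntegralRep n} (hs : s.value ≠ 0) (r : IntegralRep k)
    (r' : IntegralRep l)
    (hr : of r ∈ twistSector (mkQ (of s)) (Subalgebra.toSubmodule (Algebra.adjoin K₀ {xPi})))
    (hr' : of r' ∈ twistSector (mkQ (of s)) (Subalgebra.toSubmodule (Algebra.adjoin K₀ {xPi})))
    (hv : r.value = r'.value) : Equivalent r r' :=
  kz_twistSector evalInjective_adjoin_xPi (by rwa [evalQ_mkQ, eval_of]) r r' hr hr' hv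

/-- Example: `B₃ × S ∼ B₃ × Z` (five-dimensional representations of `ζ(3)ζ(2)`), decided on the
twisted `π`-sector. -/
theorem kz_zetaThreeBox_prod_unitSquare :
    Equivalent (zetaThreeBox.prod unitSquareRep) (zetaThreeBox.prod zetaTwoRep) :=
  kz_twist_piSector zetaThreeBox_value_ne_zero _ _
    (of_prod_mem_twistSector_pi _ of_unitSquareRep_mem_piSector)
    (of_prod_mem_twistSector_pi _ of_zetaTwoRep_mem_piSector)
    (by rw [IntegralRep.value_prod, IntegralRep.value_prod, unitSquareRep_value, zetaTwoRep_value])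

end Summit.KontsevichZagierPeriods.KontsevichZagierPeriods.Theorems.SoloBlind

end
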